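import Summits.CriticalPhenomena.PercolationContinuityZ3.Theorems.Transplant.SkelPhiCellsAnchSGbV
import Summits.CriticalPhenomena.PercolationContinuityZ3.Theorems.Transplant.SkelPhiFaceRunNb
import Summits.CriticalPhenomena.PercolationContinuityZ3.Theorems.Transplant.SkelPhiConcScheduleN
import Summits.CriticalPhenomena.PercolationContinuityZ3.Theorems.Transplant.KNCells2RunInvO
import Summits.CriticalPhenomena.PercolationContinuityZ3.Theorems.Transplant.KNCells2CoverO
import Summits.CriticalPhenomena.PercolationContinuityZ3.Theorems.Transplant.PlanarCells2SepInfV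
import Summits.CriticalPhenomena.PercolationContinuityZ3.Theorems.Transplant.SkelPhiCellsRoomsV
import HarnessLib

/-!
((R-45) V PORT of `SkelPhiNegReachDeepOT` (p5-g16 port, p5-g17 verification; rulings lead g12 11:31:15Z, design owner p3-g17 (R-44)/(R-45)): the cell layer `PCells2T` ↦ `PCells2V`
(per-axis ASYMMETRIC transverse room `σ·[−hB, hF]`, PlanarCells2VDefs, hp-8 g42/g43), names per hp-8's renamedV/modmapV + the stmt-g21/g22 V choice layer (forward-room slot `hv`);
cell-free lemmas are NOT re-declared (imported from the S/T originals). Text otherwise verbatim except the across-room reading rows `±2·r⊥ ↦ (−hB du.1 + 1, hF du.1 − 1)`.)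
# N2 (frames-only node `SamePDropOfSkeletonFrm₁`, OPEN), (C) column, J15 REPAIR: ALONG A RUN OF THE ORIENTED SCHEME OVER THE STAGGERED SMALL-BOX
# CELLS every explored vertex adjacent to the fresh corridor world `E_{v,x} ∪ H_{x,y}` of the chosen probe is DEPTH-DEEP —
# `d_G(t, ·) ≤ E(nS α v)` — `Skelφ.deep_of_run₂bOV`, the port of N1's `Skelφ.deep_of_run₂b` (SkelPhiNegReachDeepB, p5 gen 9) to the
# oriented history (`hst₂O`, `RunInv₂O`, `det_tgt_of_probe₂O`, `anchors_tgt_of_probe₂O`) and hp-8 g40's staggered cells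
# (`cellGeomSG₂bV`, `probeWorldNS`, `Q/BtwNS/Stub_sepInf_probeWorldNS`)

WHY (J15, lane INBOX 2026-08-23T05:27:27Z): the (C) residue's rim-excess device (`real_rim_le_corrO`) needs the explored neighbours of the fresh habitat
at depth `R₀` with `R₀ + 1 ≤ R₁ ≤ R − r₀` below the corridor window `R < rQ α x = E(nQ α x)`; the validity-level lemma `deep_of_valid₂OV` only gives
`R₀ ≥ rB α v e.2 = E(nQ α x)` — unsatisfiable. Along a RUN the sharp depth is one level lower, `E(nS α v) = E(nQ α x − 1)`: the explored region is the
root cube plus the new regions of the earlier probes; off the lineage those are ℓ^∞-gap-2 separated from the probe world, on the lineage `u = v` the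
windows have radii `E(nQ α' v) = E(nS α v)` (realised anchors).
builds on p205010 (kernel theorem, internal audit signed; external expert review pending) — nothing in this file uses p205010; nothing here is a claim
about the open node `SamePDropOfSkeletonFrm₁`.
Lane `prim-bschramm`, seat `prim-bschramm-p5` (gen 16 port, gen 17 verification; (C) lineage); helper file (`--supports stmt-CriticalPhenomena-4575 --as helper`).
[cite: KozmaNitzan2024, §4 pp. 26–27 ((29), E_{i+1}), p. 31] [cite: MartineauTassion2017, §4.3 Lemma 4.2]
-/

noncomputable section

open scoped Classical

namespace Summit.CriticalPhenomena.PercolationContinuityZ3.Theorems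

namespace Transplant

namespace Skelφ

open Literature.Probability.Percolation Literature.Probability.LatticeModels SimpleGraph GadgetSystem ProbeHistory HSiteScheme Contour KNCells
open Literature.Probability.Percolation.KozmaNitzan.Cells (sgOf stepVec_apply_fst stepVec_apply_oth)
open Literature.Barriers.CriticalPhenomena (graphBall graphBall_mono mem_graphBall_self)
open BoxProdZ2 (Realised ConcRadiiG nQ nS gen0 Erad Frad Erad_mono)
open Skel (E₀_le_Erad)

variable {V : Type} [DecidableEq V] {G : SimpleGraph V} [G.LocallyFinite] {φ : V → Site 2}

/-- **Explored neighbours of the fresh corridor world are depth-deep along a run of the oriented small-box staggered scheme**: after `n` steps of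
the run on `ω`, if the edge `e = (v → x)` is chosen and `du` is onward at `x`, every explored vertex adjacent to an unexplored vertex of
`E^α_{v,x} ∪ H_{x, x+du}` (any departure anchor `a'`) lies in `B_G(t, E(nS α v))`, `α := aOf₁O` the arrival anchor of `v`.
[cite: KozmaNitzan2024, §4 pp. 26–27 ((29), E_{i+1}), p. 31] -/
theorem deep_of_run₂bOV [Countable V] (hlip : Lip G φ) (hws : WeakSteps G φ) (P : PCells2V) (t : V) (gap gap' : ℕ → ℕ) (E₀ L' : ℕ)
    (off : Site 2 → ℕ) (q : unitInterval) (δc : ℝ) (b₀ : Fin 2 → ℕ) (hΛ : WFS2 P.toPCells2 (concRadii2N P.toPCells2 gap gap' E₀ L' off)) (hφ : φ t = 0)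
    (hgap : ∀ n, 20 * P.rmax ≤ gap n) {c : ℕ} (hgapc : ∀ n, c ≤ gap n)
    (hoff : ∀ x : Site 2, off x ≤ c * ((x 0).natAbs + (x 1).natAbs) + 1) (hE₀ : 1 ≤ E₀)
    (hcol : ∀ a x, ∃ y ∈ VWin G φ t (PCells2V.Q P x) ((concRadii2N P.toPCells2 gap gap' E₀ L' off).rQ a x), φ y = P.cenS x)
    (ω : BondConfig V) (n : ℕ) {e : Site 2 × MDir}
    (hc : (((⟨cellGeomSG₂bV G φ P t (concRadii2N P.toPCells2 gap gap' E₀ L' off) b₀, q, δc⟩ : KSchA V ℕ).scheme₂O G).ostN KSchA.qNE n ω).ochoice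
      KSchA.qNE = some e) {du : MDir}
    (hdu : du ∈ (⟨cellGeomSG₂bV G φ P t (concRadii2N P.toPCells2 gap gap' E₀ L' off) b₀, q, δc⟩ : KSchA V ℕ).onwardO G
      ((⟨cellGeomSG₂bV G φ P t (concRadii2N P.toPCells2 gap gap' E₀ L' off) b₀, q, δc⟩ : KSchA V ℕ).hst₂O G ω n) (tgt e)) (a' : ℕ) :
    ∀ a ∈ (⟨cellGeomSG₂bV G φ P t (concRadii2N P.toPCells2 gap gap' E₀ L' off) b₀, q, δc⟩ : KSchA V ℕ).Vx G
        ((⟨cellGeomSG₂bV G φ P t (concRadii2N P.toPCells2 gap gap' E₀ L' off) b₀, q, δc⟩ : KSchA V ℕ).hst₂O G ω n),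
      ∀ b ∈ (⟨cellGeomSG₂bV G φ P t (concRadii2N P.toPCells2 gap gap' E₀ L' off) b₀, q, δc⟩ : KSchA V ℕ).Γ.Ewv
          ((⟨cellGeomSG₂bV G φ P t (concRadii2N P.toPCells2 gap gap' E₀ L' off) b₀, q, δc⟩ : KSchA V ℕ).aOf₁O G
            ((⟨cellGeomSG₂bV G φ P t (concRadii2N P.toPCells2 gap gap' E₀ L' off) b₀, q, δc⟩ : KSchA V ℕ).hst₂O G ω n) e) e.1 e.2 ∪
        (faceDataSGV G φ P t (concRadii2N P.toPCells2 gap gap' E₀ L' off)).Hfull a' (tgt e) du,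
      b ∉ (⟨cellGeomSG₂bV G φ P t (concRadii2N P.toPCells2 gap gap' E₀ L' off) b₀, q, δc⟩ : KSchA V ℕ).Vx G
          ((⟨cellGeomSG₂bV G φ P t (concRadii2N P.toPCells2 gap gap' E₀ L' off) b₀, q, δc⟩ : KSchA V ℕ).hst₂O G ω n) →
      G.Adj a b →
      a ∈ graphBall G t (Erad gap gap' E₀ (nS ((⟨cellGeomSG₂bV G φ P t (concRadii2N P.toPCells2 gap gap' E₀ L' off) b₀, q, δc⟩ : KSchA V ℕ).aOf₁O G
        ((⟨cellGeomSG₂bV G φ P t (concRadii2N P.toPCells2 gap gap' E₀ L' off) b₀, q, δc⟩ : KSchA V ℕ).hst₂O G ω n) e) e.1)) := by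
  -- abbreviations
  set Λ := concRadii2N P.toPCells2 gap gap' E₀ L' off with hΛdef
  set S : KSchA V ℕ := ⟨cellGeomSG₂bV G φ P t Λ b₀, q, δc⟩ with hSdef
  set h := S.hst₂O G ω n with hhdef
  set α := S.aOf₁O G h e with hαdef
  have hI : S.RunInv₂O G ω n := KSchA.runInv₂O (runGeomSG₂bV _ _ _) (anchGeomSG₂bV _ _ _) ω n
  have hsep : SepGeom G S.Γ := sepGeomSG₂bV P t b₀ hΛ hφ hlip hws hcol
  set v := e.1 with hvdef
  set x := tgt e with hxdef
  set y := tgt e + stepVec du with hydef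
  have hxv : x = v + stepVec e.2 := rfl
  -- `x` is undetermined, `y` has an unexplored column, `v` is occupied
  have hcand := HState.cand_of_ochoice hc
  have hxndet : ¬((S.scheme₂O G).ostN KSchA.qNE n ω).Det x := hcand.2
  have hcolfree : ∀ z ∈ S.Vx G h, z ∉ S.Γ.col y := by
    intro z hz
    have hon : du ∈ S.onward G h (tgt e) := ((KSchA.mem_onwardO G S).1 hdu).1
    rw [KSchA.onward, Finset.mem_filter] at hon
    exact hon.2 z hz
  have hyndet : ¬((S.scheme₂O G).ostN KSchA.qNE n ω).Det y := by
    intro hdet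
    obtain ⟨a₁, hQ⟩ := hI.det_Q y hdet
    obtain ⟨z, hz, hzc⟩ := hsep.col_Q a₁ y
    exact hcolfree z (hQ hz) hzc
  have hvdet : ((S.scheme₂O G).ostN KSchA.qNE n ω).Det v := Or.inl hcand.1
  have hyv : v + stepVec e.2 + stepVec du ≠ v := fun hh =>
    hyndet (by rw [show y = v + stepVec e.2 + stepVec du from rfl, hh]; exact hvdet)
  intro a ha b hb _ hadj
  -- planar footprint of `b`: the probe world of record
  have hb2 : φ b ∈ P.probeWorldNS v e.2 du := footprint_mem_probeWorldNS_of_mem_habΩV hb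
  rcases hI.V_cases a ha with haQ | ⟨m, hm, e', hc', -, hD', ha'⟩
  · -- the root cube: depth `rQ 0 0 = max (E (nQ 0 0)) (off 0) ≤ E (nS α v)`
    change a ∈ VWin G φ t (PCells2V.Q P 0) (Λ.rQ 0 0) at haQ
    have ha1 : a ∈ graphBall G t (Λ.rQ 0 0) := mem_graphBall_of_mem_VWin haQ
    refine graphBall_mono G t ?_ ha1
    change max (Erad gap gap' E₀ (nQ 0 0)) (max (off2 P.toPCells2 0) (off 0)) ≤ _
    refine max_le (Erad_mono gap gap' E₀ (by simp [nQ])) (max_le ?_ ?_)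
    · have hoff2 : off2 P.toPCells2 0 = 1 := by simp [off2]
      rw [hoff2]
      exact hE₀.trans (E₀_le_Erad gap gap' E₀ _)
    · have h0 : off 0 ≤ 1 := by have := hoff 0; simpa using this
      exact h0.trans (hE₀.trans (E₀_le_Erad gap gap' E₀ _))
  · -- an earlier probe `e' = (w → u)`
    set h' := S.hst₂O G ω m with hh'def
    set α' := S.aOf₁O G h' e' with hα'def
    set β' := S.aOf₂O G h' e' with hβ'def
    set u := tgt e' with hudef
    have hc'' : (S.astOf₂O G h').st.ochoice KSchA.qNE = some e' := by rw [← S.stN_eq₂O]; exact hc'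
    have hreal : Realised α' β' u := realised_of_choice_SG₂bV h' hc''
    have hnorm : (u 0).natAbs + (u 1).natAbs ≤ nQ α' u := l1_tgt_le_nQ₂bV h' hc''
    have hudet : ((S.scheme₂O G).ostN KSchA.qNE n ω).Det u := KSchA.det_tgt_of_probe₂O hm hc' hD'
    have hwdet : ((S.scheme₂O G).ostN KSchA.qNE n ω).Det e'.1 :=
      (S.scheme₂O G).det_ostN_mono KSchA.qNE ω hm.le (Or.inl (HState.cand_of_ochoice hc').1)
    -- membership of `a` in the new region of `e'`
    have ha'' : a ∈ S.Γ.Ewv α' e'.1 e'.2 ∪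
        (S.onwardO G h' u).biUnion fun d => S.Γ.Stub β' u d (S.jOf G h' e' α' β' d (S.oOf₂O G ω h' e')) := ha'
    by_cases huv : u = v
    · -- THE LINEAGE: depth `E (nQ α' u) = E (nS β' u) = E (nS α v)`
      have harr : (S.astOf₂O G h).arr u = β' := (KSchA.anchors_tgt_of_probe₂O hm hc' hD').1
      have hαβ : α = β' := by
        rw [hαdef, KSchA.aOf₁O]
        show (S.astOf₂O G h).arr v = β'
        rw [← huv]; exact harr
      have hE : Erad gap gap' E₀ (nQ α' u) = Erad gap gap' E₀ (nS α v) := by rw [hαβ, ← huv, hreal.nS_eq]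
      rcases Finset.mem_union.1 ha'' with ha3 | ha3
      · rw [CellGeom.Ewv] at ha3
        rcases Finset.mem_union.1 ha3 with ha3 | ha3
        · change a ∈ VWin G φ t (PCells2V.BtwNS P e'.1 e'.2) (Λ.rB α' e'.1 e'.2) at ha3
          have ha1 : a ∈ graphBall G t (Λ.rB α' e'.1 e'.2) := mem_graphBall_of_mem_VWin ha3
          rw [← hE]
          exact ha1
        · change a ∈ VWin G φ t (PCells2V.Q P (e'.1 + stepVec e'.2)) (Λ.rQ α' (e'.1 + stepVec e'.2)) at ha3
          have ha1 : a ∈ graphBall G t (Λ.rQ α' (e'.1 + stepVec e'.2)) := mem_graphBall_of_mem_VWin ha3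
          rw [← hE, ← concRadii2N_rQ_eq_of_norm_le P.toPCells2 gap' E₀ L' off hgap hgapc hE₀ hnorm (hoff _)]
          exact ha1
      · obtain ⟨d, -, ha4⟩ := Finset.mem_biUnion.1 ha3
        change a ∈ VStair G φ t (PCells2V.Stub P u d _) (profV P Λ β' u d) at ha4
        have ha1 := (mem_of_mem_VStair ha4).2
        refine graphBall_mono G t ?_ ha1
        rw [hαβ, ← huv]
        exact (concRadii2N_ρ_le P.toPCells2 gap gap' E₀ L' off β' u d _).trans (Nat.sub_le _ _)
    · -- OFF THE LINEAGE: planar ℓ^∞-gap-2 separation forbids the edge (`lip`)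
      exfalso
      have hux : u ≠ v + stepVec e.2 := fun hh => hxndet (by rw [hxv, ← hh]; exact hudet)
      have huy : u ≠ v + stepVec e.2 + stepVec du := fun hh =>
        hyndet (by rw [show y = v + stepVec e.2 + stepVec du from rfl, ← hh]; exact hudet)
      have hwx : e'.1 ≠ v + stepVec e.2 := fun hh => hxndet (by rw [hxv, ← hh]; exact hwdet)
      have hwy : e'.1 ≠ v + stepVec e.2 + stepVec du := fun hh =>
        hyndet (by rw [show y = v + stepVec e.2 + stepVec du from rfl, ← hh]; exact hwdet)
      rcases Finset.mem_union.1 ha'' with ha3 | ha3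
      · rw [CellGeom.Ewv] at ha3
        rcases Finset.mem_union.1 ha3 with ha3 | ha3
        · change a ∈ VWin G φ t (PCells2V.BtwNS P e'.1 e'.2) (Λ.rB α' e'.1 e'.2) at ha3
          have ha2 : φ a ∈ PCells2V.BtwNS P e'.1 e'.2 := φ_mem_of_mem_VWin ha3
          have hwv : e'.1 + stepVec e'.2 ≠ v := huv
          exact (ne_not_adj_of_sepInf hlip
            (P.BtwNS_sepInf_probeWorldNS v e.2 du e'.1 e'.2 hyv hwx hwy hwv hux huy) ha2 hb2).2 hadj
        · change a ∈ VWin G φ t (PCells2V.Q P (e'.1 + stepVec e'.2)) (Λ.rQ α' (e'.1 + stepVec e'.2)) at ha3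
          have ha2 : φ a ∈ PCells2V.Q P u := φ_mem_of_mem_VWin ha3
          exact (ne_not_adj_of_sepInf hlip (P.Q_sepInf_probeWorldNS v e.2 du u hyv huv hux huy) ha2 hb2).2 hadj
      · obtain ⟨d, -, ha4⟩ := Finset.mem_biUnion.1 ha3
        change a ∈ VStair G φ t (PCells2V.Stub P u d _) (profV P Λ β' u d) at ha4
        have ha2 := (mem_of_mem_VStair ha4).1
        have hj : S.jOf G h' e' α' β' d (S.oOf₂O G ω h' e') + 1 ≤ P.K := S.jOf_lt h' e' α' β' d _
        exact (ne_not_adj_of_sepInf hlip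
          (P.Stub_sepInf_probeWorldNS v e.2 du u d _ hyv huv hux huy hj) ha2 hb2).2 hadj

end Skelφ

end Transplant

end Summit.CriticalPhenomena.PercolationContinuityZ3.Theorems

end
-- build-touch 2026-08-25T06:38Z T1-A (lead g18; filed by hp-8 g49 under G2 for the p5 pen): re-land of p391591, declarations byte-identical
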